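import Summits.NavierStokesRegularity.NavierStokesRegularity.Theorems.EpisodeBaseT.Negative.RingPusherMirrorAnchorSign
import Summits.NavierStokesRegularity.FluidComputer.PalasekTowerTameCarrierAt
import HarnessLib

/-!
# A `z ↦ −z`-SYMMETRIC far pusher has anchor number exactly ZERO: the strict anchor of the sterile carrier needs a
# mirror-ASYMMETRIC device (Negative lane, `EpisodeBaseT`, line «doormirror», stub D2a `SterileSmallCarrierT`)

Cell `ns-blowup`, seat `ns-blowup-refuter4` (g12; D-0074 GROUP C «BRIDGE SUPPORT», Negative lane (α)). Third file of the
mirror series (p567521 `RingPusherMirrorAnchorSign`, p569185 `SterileCarrierMirrorNotLevelZero`).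

p567521 proved `∫ D³Γ(0 − x)(P♭ x, P♭ x, c e₃) dx = −∫ D³Γ(0 − x)(P x, P x, c e₃) dx` for the mirrored field
`P♭ = M ∘ P ∘ M` (`M (x₀,x₁,x₂) = (x₀,x₁,−x₂)`). Hence:

* `integral_anchorIntegrand_eq_zero_of_mirror_invariant` — if `P` is MIRROR-INVARIANT (`M (P (M y)) = P y`, `P 0 = 0`)
  its anchor integral against every `c e₃` is `0`.
* `not_strictAnchor_add_of_mirror_invariant` — for an even-about-`0` admissible `U₁` supported in `B(0, r₁)` with
  `U₁ 0 = c e₃` and `−ν⟪U₁ 0, ΔU₁ 0⟫ ≥ 0`, and ANY smooth compactly supported divergence-free mirror-invariant `P`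
  supported in `‖x‖ ≥ r₁`: the strict anchor `0 < ⟪U 0, accel ν U 0⟫` FAILS for `U = U₁ + P` (by
  `anchor_test_iff_fderiv3` the test reads `−ν⟪U₁ 0, ΔU₁ 0⟫ < ∫ = 0`).
* `not_levelZeroDataAt_tinyProfileAt_add_of_mirror_invariant` — on the BLOB OF RECORD `tinyProfileAt R a` (`0 < a ≤ 2`):
  `¬ LevelZeroDataAt R (tinyProfileAt R a + P) ρ` for every such `P` supported in `‖x‖ ≥ 9/2`, every `ρ`, every `R`.
* `mirror_invariant_smul_ringPair`, `not_levelZeroDataAt_tinyProfileAt_add_smul_ringPair` — the instance: the SYMMETRIC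
  RING PAIR `μ • (ringPusher δ + mirrorRingPusher δ)` (fc-prover-2's ring above the blob TOGETHER WITH its mirror image
  below; sterile, smooth, divergence free, compactly supported) never fills level 0 with the blob of record — for every
  amplitude `μ` (including the one that works for the single ring above, p565496 `levelZeroDataAt_sterileCarrierAt`) and
  every thinness `0 < δ ≤ 1/4`.

Reading for the stub: the D2a device is intrinsically CHIRAL in `z` — side matters (p569185) and symmetric arrangements
cancel exactly (this file); «add more sterile rings» is not monotone in the anchor number.

LABEL: kernel analysis (theorems only). WHAT THIS IS NOT: not Navier–Stokes evidence; not a refutation of D2a (existential,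
and a theorem by name since p569312) or of any route item; no flow, stage, schedule or certificate; sorry-free, std axioms.
bears_on: LADDER-NS N1 (route-NavierStokesRegularity-PalasekTowerBreakdown), item 20303, stub D2a.

References: A. J. Majda, A. L. Bertozzi (CUP 2002) §1.8 Prop. 1.16 [cite: MajdaBertozziCUP2002, §1.8 Prop. 1.16].
-/

noncomputable section

open Literature.Analysis.FluidPDE
open Summit.NavierStokesRegularity.FluidComputer.PalasekTowerClayBridge
open Summit.NavierStokesRegularity.FluidComputer.PalasekTowerClayBridge.TinyBlob
open Summit.NavierStokesRegularity.FluidComputer.PalasekTowerClayBridge.Germ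
open Summit.NavierStokesRegularity.EpisodeBaseTRingPusherMirrorAnchorSign
open MeasureTheory InnerProductSpace Metric Set
open scoped RealInnerProductSpace ContDiff Laplacian

-- nested operator types `ℝ³ →L[ℝ] ℝ³ →L[ℝ] ℝ`
set_option maxSynthPendingDepth 3

namespace Summit.NavierStokesRegularity.EpisodeBaseTMirrorInvariantPusherNoAnchor

/-! ## §1 Mirror-invariant fields have anchor number zero -/

/-- **Mirror-invariant ⇒ anchor integral `0`**: if `M (P (M y)) = P y` for all `y` and `P 0 = 0`, then
`∫ D³Γ(0 − x)(P x, P x, c e₃) dx = 0` for every `c` (it equals its own negative, p567521). [cite: MajdaBertozziCUP2002, §1.8 Prop. 1.16] -/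
theorem integral_anchorIntegrand_eq_zero_of_mirror_invariant (P : EuclideanSpace ℝ (Fin 3) → EuclideanSpace ℝ (Fin 3))
    (hP : ∀ y, mirrorZ (P (mirrorZ y)) = P y) (hP0 : P 0 = 0) (c : ℝ) :
    ∫ x, anchorIntegrand P c x = 0 := by
  have h := integral_anchorIntegrand_mirror P hP0 c
  have hfun : (fun y => mirrorZ (P (mirrorZ y))) = P := funext hP
  rw [hfun] at h
  linarith

/-- **The strict anchor FAILS for an even core plus ANY mirror-invariant far pusher.** `U₁ ∈ C_c^∞` divergence free,
even about `0`, `tsupport U₁ ⊆ B(0, r₁)`, `U₁ 0 = c e₃`, `−ν⟪U₁ 0, ΔU₁ 0⟫ ≥ 0`; `P ∈ C_c^∞` divergence free,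
mirror-invariant, `tsupport P ⊆ {‖x‖ ≥ r₁}`. Then `¬ 0 < ⟪(U₁ + P) 0, accel ν (U₁ + P) 0⟫`. [cite: MajdaBertozziCUP2002, §1.8 Prop. 1.16] -/
theorem not_strictAnchor_add_of_mirror_invariant {ν : ℝ}
    {U₁ P : EuclideanSpace ℝ (Fin 3) → EuclideanSpace ℝ (Fin 3)} (h₁ : ContDiff ℝ ∞ U₁) (h₁c : HasCompactSupport U₁)
    (hdiv₁ : VectorCalculus.IsDivFree U₁) (he : IsEvenAbout 0 U₁) {r₁ : ℝ} (hr₁ : 0 < r₁)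
    (hsupp : tsupport U₁ ⊆ ball (0 : EuclideanSpace ℝ (Fin 3)) r₁)
    (h₂ : ContDiff ℝ ∞ P) (h₂c : HasCompactSupport P) (hdiv₂ : VectorCalculus.IsDivFree P)
    (hfarP : ∀ x ∈ tsupport P, r₁ ≤ ‖x‖) (hP : ∀ y, mirrorZ (P (mirrorZ y)) = P y)
    {c : ℝ} (hU0 : U₁ 0 = c • e₃) (hΔ : 0 ≤ -(ν * ⟪U₁ 0, (Δ U₁) 0⟫)) :
    ¬ 0 < ⟪(U₁ + P) 0, accel ν (U₁ + P) 0⟫ := fun hpos => by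
  have hP0 : P 0 = 0 := image_eq_zero_of_notMem_tsupport fun h0 => by
    have := hfarP 0 h0
    rw [norm_zero] at this
    linarith
  have hd : Disjoint (tsupport U₁) (tsupport P) :=
    disjoint_left.2 fun x hx₁ hx₂ => (not_le.2 (mem_ball_zero_iff.1 (hsupp hx₁))) (hfarP x hx₂)
  have hfar : ∀ x ∈ tsupport P, r₁ / 2 < ‖(0 : EuclideanSpace ℝ (Fin 3)) - x‖ := fun x hx => by
    rw [zero_sub, norm_neg]
    linarith [hfarP x hx]
  have h0 : ∫ x, fderiv ℝ (fun w => fderiv ℝ (fun w' => fderiv ℝ newtonKernel w' (P x)) w (P x))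
      ((0 : EuclideanSpace ℝ (Fin 3)) - x) (U₁ 0) = 0 := by
    rw [hU0]
    exact integral_anchorIntegrand_eq_zero_of_mirror_invariant P hP hP0 c
  have h1 := (anchor_test_iff_fderiv3 (ν := ν) h₁ h₁c hdiv₁ he h₂ h₂c hdiv₂ hd (by linarith : (0 : ℝ) < r₁ / 2)
    hfar).1 hpos
  linarith

/-! ## §2 On the blob of record -/

/-- **The blob of record plus ANY mirror-invariant far pusher is NOT level-0 data** (`0 < a ≤ 2`; `P ∈ C_c^∞`
divergence free, mirror-invariant, `tsupport P ⊆ {‖x‖ ≥ 9/2}`; every radius `ρ`, every rates record `R`): the `anchor`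
field fails at the speed-ceiling point `x = 0`. [cite: MajdaBertozziCUP2002, §1.8 Prop. 1.16] -/
theorem not_levelZeroDataAt_tinyProfileAt_add_of_mirror_invariant (R : TowerRates) {a : ℝ} (ha : 0 < a) (ha2 : a ≤ 2)
    {P : EuclideanSpace ℝ (Fin 3) → EuclideanSpace ℝ (Fin 3)} (h₂ : ContDiff ℝ ∞ P) (h₂c : HasCompactSupport P)
    (hdiv₂ : VectorCalculus.IsDivFree P) (hfarP : ∀ x ∈ tsupport P, (9 / 2 : ℝ) ≤ ‖x‖)
    (hP : ∀ y, mirrorZ (P (mirrorZ y)) = P y) (ρ : ℝ) :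
    ¬ LevelZeroDataAt R (tinyProfileAt R a + P) ρ := fun hL => by
  obtain ⟨heven, -, hflat⟩ := tinyProfileAt_even_flat R a
  have hsupp : tsupport (tinyProfileAt R a) ⊆ ball (0 : EuclideanSpace ℝ (Fin 3)) (9 / 2) := fun x hx => by
    have h := tsupport_tinyProfileAt_subset (R := R) ha hx
    rw [mem_closedBall, dist_zero_right] at h
    rw [mem_ball, dist_zero_right]
    linarith
  have hΔ : 0 ≤ -(1 * ⟪tinyProfileAt R a 0, (Δ (tinyProfileAt R a)) 0⟫) := by
    rw [hflat, inner_zero_right, mul_zero, neg_zero]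
  have hP0 : P 0 = 0 := image_eq_zero_of_notMem_tsupport fun h0 => by
    have := hfarP 0 h0
    rw [norm_zero] at this
    linarith
  refine not_strictAnchor_add_of_mirror_invariant (ν := 1) (contDiff_tinyProfileAt R a)
    (hasCompactSupport_tinyProfileAt ha) (isDivFree_tinyProfileAt ha.ne') heven (by norm_num : (0 : ℝ) < 9 / 2) hsupp
    h₂ h₂c hdiv₂ hfarP hP (tinyProfileAt_zero R a).1 hΔ (hL.anchor 0 ?_)
  rw [Pi.add_apply, hP0, add_zero]
  exact (tinyProfileAt_zero R a).2

/-! ## §3 The instance: the symmetric ring pair (ring above + its mirror below) -/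

/-- The symmetric ring pair `μ • (P_δ + P♭_δ)` is mirror-invariant. [folklore] -/
theorem mirror_invariant_smul_ringPair (μ δ : ℝ) (y : EuclideanSpace ℝ (Fin 3)) :
    mirrorZ ((μ • (ringPusher δ + mirrorRingPusher δ)) (mirrorZ y)) = (μ • (ringPusher δ + mirrorRingPusher δ)) y := by
  simp only [Pi.smul_apply, Pi.add_apply, mirrorRingPusher, mirrorZ_mirrorZ, map_smul, map_add]
  rw [add_comm]

/-- The symmetric ring pair vanishes on `‖x‖ < 9/2`. [folklore] -/
theorem smul_ringPair_eq_zero_of_norm_lt {δ : ℝ} (hδ : 0 < δ) (hδ4 : δ ≤ 1 / 4) (μ : ℝ)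
    {x : EuclideanSpace ℝ (Fin 3)} (hx : ‖x‖ < 9 / 2) : (μ • (ringPusher δ + mirrorRingPusher δ)) x = 0 := by
  rw [Pi.smul_apply, Pi.add_apply, ringPusher_eq_zero_of_norm_lt hδ hδ4 hx, mirrorRingPusher_eq_zero_of_norm_lt hδ hδ4 hx,
    add_zero, smul_zero]

/-- On the support of the symmetric ring pair, `‖x‖ ≥ 9/2`. [folklore] -/
theorem norm_ge_of_mem_tsupport_smul_ringPair {δ : ℝ} (hδ : 0 < δ) (hδ4 : δ ≤ 1 / 4) (μ : ℝ)
    {x : EuclideanSpace ℝ (Fin 3)} (hx : x ∈ tsupport (μ • (ringPusher δ + mirrorRingPusher δ))) : (9 / 2 : ℝ) ≤ ‖x‖ := by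
  have hcl : IsClosed {y : EuclideanSpace ℝ (Fin 3) | (9 / 2 : ℝ) ≤ ‖y‖} := isClosed_le continuous_const continuous_norm
  refine (closure_minimal (fun y hy => ?_) hcl) hx
  by_contra hlt
  exact hy (smul_ringPair_eq_zero_of_norm_lt hδ hδ4 μ (not_le.1 hlt))

/-- The symmetric ring pair is smooth. [folklore] -/
theorem contDiff_smul_ringPair (μ δ : ℝ) : ContDiff ℝ ∞ (μ • (ringPusher δ + mirrorRingPusher δ)) :=
  ((contDiff_ringPusher δ).add (contDiff_mirrorRingPusher δ)).const_smul μ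

/-- The symmetric ring pair has compact support (`0 < δ ≤ 1/4`). [folklore] -/
theorem hasCompactSupport_smul_ringPair {δ : ℝ} (hδ : 0 < δ) (hδ4 : δ ≤ 1 / 4) (μ : ℝ) :
    HasCompactSupport (μ • (ringPusher δ + mirrorRingPusher δ)) :=
  ((hasCompactSupport_ringPusher hδ hδ4).add (hasCompactSupport_mirrorRingPusher hδ hδ4)).comp_left
    (g := fun v : EuclideanSpace ℝ (Fin 3) => μ • v) (smul_zero μ)

/-- The ring pair is divergence free (the divergence is additive). [folklore] -/
theorem isDivFree_ringPair (δ : ℝ) : VectorCalculus.IsDivFree (ringPusher δ + mirrorRingPusher δ) := fun x => by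
  show VectorCalculus.divergence (fun y => ringPusher δ y + mirrorRingPusher δ y) x = 0
  rw [divergence_add_apply (((contDiff_ringPusher δ).differentiable (by simp)) x)
    (((contDiff_mirrorRingPusher δ).differentiable (by simp)) x), isDivFree_ringPusher δ x,
    isDivFree_mirrorRingPusher δ x, add_zero]

/-- The symmetric ring pair is divergence free. [folklore] -/
theorem isDivFree_smul_ringPair (μ δ : ℝ) : VectorCalculus.IsDivFree (μ • (ringPusher δ + mirrorRingPusher δ)) :=
  VectorCalculus.IsDivFree.const_smul
    (((contDiff_ringPusher δ).add (contDiff_mirrorRingPusher δ)).differentiable (by simp)) (isDivFree_ringPair δ) μ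

/-- Rotations about the axis are linear: `R_θ (μ (a + b)) = μ (R_θ a + R_θ b)`. [folklore] -/
theorem rotZ_smul_add (θ μ : ℝ) (a b : EuclideanSpace ℝ (Fin 3)) :
    rotZ θ (μ • (a + b)) = μ • (rotZ θ a + rotZ θ b) := by
  ext i; fin_cases i <;> simp <;> ring

/-- The symmetric ring pair is sterile: axisymmetric and swirl-free. [folklore] -/
theorem isAxisymmetric_hasNoSwirl_smul_ringPair (μ δ : ℝ) :
    IsAxisymmetric (μ • (ringPusher δ + mirrorRingPusher δ)) ∧ HasNoSwirl (μ • (ringPusher δ + mirrorRingPusher δ)) := by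
  refine ⟨fun θ x => ?_, fun x => ?_⟩
  · simp only [Pi.smul_apply, Pi.add_apply, isAxisymmetric_ringPusher δ θ x, isAxisymmetric_mirrorRingPusher δ θ x,
      rotZ_smul_add]
  · have h1 := hasNoSwirl_ringPusher δ x
    have h2 := hasNoSwirl_mirrorRingPusher δ x
    simp only [swirl] at h1 h2 ⊢
    simp only [Pi.smul_apply, Pi.add_apply, PiLp.smul_apply, PiLp.add_apply, smul_eq_mul]
    linear_combination μ * h1 + μ * h2

/-- **THE SYMMETRIC RING PAIR NEVER FILLS LEVEL 0 WITH THE BLOB OF RECORD**: for `0 < a ≤ 2`, `0 < δ ≤ 1/4`, EVERY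
amplitude `μ` and every radius `ρ`, `¬ LevelZeroDataAt R (tinyProfileAt R a + μ • (ringPusher δ + mirrorRingPusher δ)) ρ`.
[cite: MajdaBertozziCUP2002, §1.8 Prop. 1.16] -/
theorem not_levelZeroDataAt_tinyProfileAt_add_smul_ringPair (R : TowerRates) {a : ℝ} (ha : 0 < a) (ha2 : a ≤ 2)
    {δ : ℝ} (hδ : 0 < δ) (hδ4 : δ ≤ 1 / 4) (μ ρ : ℝ) :
    ¬ LevelZeroDataAt R (tinyProfileAt R a + μ • (ringPusher δ + mirrorRingPusher δ)) ρ :=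
  not_levelZeroDataAt_tinyProfileAt_add_of_mirror_invariant R ha ha2 (contDiff_smul_ringPair μ δ)
    (hasCompactSupport_smul_ringPair hδ hδ4 μ) (isDivFree_smul_ringPair μ δ)
    (fun _ hx => norm_ge_of_mem_tsupport_smul_ringPair hδ hδ4 μ hx) (mirror_invariant_smul_ringPair μ δ) ρ

end Summit.NavierStokesRegularity.EpisodeBaseTMirrorInvariantPusherNoAnchor

end
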